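import Mathlib
import HarnessLib
import HarnessLib.Audit
import Summits.QuantumFields.Statement
import Literature.MathematicalPhysics.QuantumLattice.LatticeGaugeDLR
import Literature.MathematicalPhysics.QuantumFieldTheory.BalabanBanachStep
import Summits.QuantumFields.YangMills.Theorems.ComplexCouplingChannelContinuumLegGivenGapSplit
import Summits.QuantumFields.YangMills.Theses.DirichletWindow
/-! Mock of the route-file context of `Theses/HyperbolicRegulator.lean` (same imports + BalabanBanachStep, same opens),
to certify that the three children of the split of `ContinuumLegGivenGap` elaborate as route items and that the landed split glue closes them. -/

namespace Summit.QuantumFields.YangMills.Theses.HyperbolicRegulatorSplitMock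

open scoped BigOperators Topology Manifold Classical MeasureTheory ProbabilityTheory Matrix InnerProductSpace ComplexConjugate ContinuousMap
open Filter Set Function TopologicalSpace MeasureTheory

/-- child 1 = stmt-QuantumFields-8941 `DirichletWindow.XiDiverges` verbatim. -/
def XiDiverges : Prop :=
  ∀ (G : Type) [Group G] [TopologicalSpace G] [IsTopologicalGroup G] [CompactSpace G] [MeasurableSpace G] [BorelSpace G], Literature.MathematicalPhysics.QuantumFieldTheory.IsCompactSimpleLieGroup G → ∀ r : Literature.MathematicalPhysics.QuantumFieldTheory.LatticeRep G, ∀ ε : ℝ, 0 < ε → ∃ β₁ : ℝ, ∀ β : ℝ, β₁ ≤ β → ∀ μ ∈ Literature.MathematicalPhysics.QuantumLattice.infiniteVolumeLimitPoints (d := 4) r.ρ β, ∃ m A : ℝ, 0 < A ∧ 0 ≤ m ∧ m ≤ ε ∧ ∀ n : ℕ, A * Real.exp (-(m * n)) ≤ Literature.MathematicalPhysics.QuantumLattice.plaquetteCorrFn r.ρ μ ((n : ℤ) • Pi.single (0 : Fin 4) (1 : ℤ))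

/-- child 2 = registered `stub_uvPackageVol` (fully qualified). -/
def VolumeUniformUVEngine : Prop :=
  ∀ (G : Type) [Group G] [TopologicalSpace G] [IsTopologicalGroup G] [CompactSpace G] [MeasurableSpace G] [BorelSpace G], Literature.MathematicalPhysics.QuantumFieldTheory.IsCompactSimpleLieGroup G → ∃ r : Literature.MathematicalPhysics.QuantumFieldTheory.LatticeRep G, ∀ (β : ℕ → ℝ) (mh : ℕ → ℝ) (S₁ : ℕ → ℕ) (K : ℝ), Tendsto β atTop atTop → (∀ k, 0 < mh k) → 0 < K → (∀ A B : Literature.MathematicalPhysics.QuantumFieldTheory.YMSpecies G, ∃ C : ℝ, ∀ k S n : ℕ, S₁ k ≤ S → n ≤ S → |Literature.MathematicalPhysics.QuantumFieldTheory.latticeConnectedCorr r.ρ (β k) (2 * S + 1) A.F B.F n| ≤ C * Real.exp (-(mh k * n))) → (∀ k S₀ : ℕ, ∃ A B : Literature.MathematicalPhysics.QuantumFieldTheory.YMSpecies G, ∀ C : ℝ, ∃ S n : ℕ, S₀ ≤ S ∧ n ≤ S ∧ C * Real.exp (-(K * mh k * n)) < |Literature.MathematicalPhysics.QuantumFieldTheory.latticeConnectedCorr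 r.ρ (β k) (2 * S + 1) A.F B.F n|) → Tendsto mh atTop (𝓝 0) → ∃ (a : ℕ → ℝ) (φ : ℕ → ℕ) (Δ₀ : ℝ) (𝓛 : ℕ → Set ℕ), (∀ k, 0 < a k) ∧ StrictMono φ ∧ 0 < Δ₀ ∧ (∀ k, Δ₀ * a k ≤ mh (φ k)) ∧ (∀ k S : ℕ, ∃ S' : ℕ, S' ∈ 𝓛 k ∧ S ≤ S') ∧ (∀ k : ℕ, ∀ S ∈ 𝓛 k, S₁ (φ k) ≤ S) ∧ (∃ N : ℕ, 1 ≤ N ∧ ∀ᶠ k in atTop, ∀ S ∈ 𝓛 k, (a k)⁻¹ ≤ (a k * (S : ℝ)) ^ N) ∧ ∀ (sch : Literature.MathematicalPhysics.QuantumFieldTheory.SpeciesScheme (Literature.MathematicalPhysics.QuantumFieldTheory.YMSpecies G)), (∀ k, sch.a k = a k) → (∀ k, sch.β k = β (φ k)) → (∀ k, sch.L k ∈ 𝓛 k) → ∀ (LS : (k n : ℕ) → SchwartzMap (Fin n → EuclideanSpace ℝ (Fin 4)) ℂ → ℂ), (∀ (k n : ℕ) (F : SchwartzMap (Fin n → EuclideanSpace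 ℝ (Fin 4)) ℂ), LS k n F = ∫ U : Literature.MathematicalPhysics.QuantumFieldTheory.GaugeConfig 4 (sch.side k) G, ∑ x : Fin n → ↥(Literature.Probability.LatticeModels.box 4 (sch.L k)), F (fun i => sch.a k • Literature.MathematicalPhysics.QuantumLattice.siteToE ↑(x i)) * ∏ i, ((sch.c r.curvature k * sch.a k ^ 4 * (r.curvature.F (Literature.MathematicalPhysics.QuantumLattice.configShift (-↑(x i)) (Literature.MathematicalPhysics.QuantumLattice.torusLift (sch.side k) U)) - sch.m r.curvature k) : ℝ) : ℂ) ∂(Literature.MathematicalPhysics.QuantumFieldTheory.wilsonMeasure r.ρ (sch.β k))) → (∀ k : ℕ, sch.m r.curvature k = ∫ U : Literature.MathematicalPhysics.QuantumFieldTheory.GaugeConfig 4 (sch.side k) G, r.curvature.F (Literature.MathematicalPhysics.QuantumLattice.torusLift (sch.side k) U) ∂(Literature.MathematicalPhysics.QuantumFieldTheory.wilsonMeasure r.ρ (sch.β k))) → (∀ k : ℕ, sch.c r.curvature k = (sch.a k ^ 4)⁻¹) → (∃ (s : ℕ) (α β' : ℝ), ∀ᶠ k in atTop, ∀ (p : ℕ)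 (q : Fin p → {q : Fin 4 × Fin 4 // q.1 < q.2}) (F : SchwartzMap (Fin p → EuclideanSpace ℝ (Fin 4)) ℂ), Literature.MathematicalPhysics.AQFT.IsOffDiagonal F → ‖∫ U : Literature.MathematicalPhysics.QuantumFieldTheory.GaugeConfig 4 (sch.side k) G, ∑ x : Fin p → ↥(Literature.Probability.LatticeModels.box 4 (sch.L k)), F (fun i => sch.a k • Literature.MathematicalPhysics.QuantumLattice.siteToE ↑(x i)) * ∏ i, ((Literature.MathematicalPhysics.QuantumLattice.plaquetteObs r.ρ 0 (q i).1.1 (q i).1.2 (Literature.MathematicalPhysics.QuantumLattice.configShift (-↑(x i)) (Literature.MathematicalPhysics.QuantumLattice.torusLift (sch.side k) U)) - Literature.MathematicalPhysics.QuantumFieldTheory.wilsonTorusMean r.ρ (sch.β k) (sch.L k) (Literature.MathematicalPhysics.QuantumLattice.plaquetteObs r.ρ 0 (q i).1.1 (q i).1.2) : ℝ) : ℂ) ∂(Literature.MathematicalPhysics.QuantumFieldTheory.wilsonMeasure r.ρ (sch.β k))‖ ≤ α * (p.factorial : ℝ) ^ β' * Literature.MathematicalPhysics.QuantumLattice.schwartzNorm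 (p * s) F) ∧ (∃ (f g : SchwartzMap (Fin 1 → EuclideanSpace ℝ (Fin 4)) ℂ) (H : SchwartzMap (Fin (1 + 1) → EuclideanSpace ℝ (Fin 4)) ℂ), Literature.MathematicalPhysics.QuantumLattice.IsTimeOrdered f ∧ Literature.MathematicalPhysics.QuantumLattice.IsTimeOrdered g ∧ Literature.MathematicalPhysics.QuantumLattice.IsAppendTensorOf H (Literature.MathematicalPhysics.QuantumLattice.osAdjoint f) g ∧ ∃ δ : ℝ, 0 < δ ∧ ∀ᶠ k in atTop, δ ≤ ‖LS k (1 + 1) H‖) ∧ (∀ R : EuclideanSpace ℝ (Fin 4) ≃ₗᵢ[ℝ] EuclideanSpace ℝ (Fin 4), R (EuclideanSpace.single 0 1) = (3 / 5 : ℝ) • EuclideanSpace.single 0 1 + (-(4 / 5) : ℝ) • EuclideanSpace.single 1 1 → R (EuclideanSpace.single 1 1) = (4 / 5 : ℝ) • EuclideanSpace.single 0 1 + (3 / 5 : ℝ) • EuclideanSpace.single 1 1 → R (EuclideanSpace.single 2 1) = EuclideanSpace.single 2 1 → R (EuclideanSpace.single 3 1) = EuclideanSpace.single 3 1 → ∀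 (n : ℕ) (F : SchwartzMap (Fin n → EuclideanSpace ℝ (Fin 4)) ℂ), Literature.MathematicalPhysics.AQFT.IsOffDiagonal F → Tendsto (fun k : ℕ => LS k n (Literature.MathematicalPhysics.QuantumLattice.linActMulti R F) - LS k n F) atTop (𝓝 0))

/-- child 3 = registered `stub_skewWindow` (fully qualified). -/
def SkewnessWindowNLO : Prop :=
  ∀ (G : Type) [Group G] [TopologicalSpace G] [IsTopologicalGroup G] [CompactSpace G] [MeasurableSpace G] [BorelSpace G], Literature.MathematicalPhysics.QuantumFieldTheory.IsCompactSimpleLieGroup G → ∀ (r : Literature.MathematicalPhysics.QuantumFieldTheory.LatticeRep G) (sch : Literature.MathematicalPhysics.QuantumFieldTheory.SpeciesScheme (Literature.MathematicalPhysics.QuantumFieldTheory.YMSpecies G)) (LS : (k n : ℕ) → SchwartzMap (Fin n → EuclideanSpace ℝ (Fin 4)) ℂ → ℂ), (∀ (k n : ℕ) (F : SchwartzMap (Fin n → EuclideanSpace ℝ (Fin 4)) ℂ), LS k n F = ∫ U : Literature.MathematicalPhysics.QuantumFieldTheory.GaugeConfig 4 (sch.side k) G, ∑ x : Fin n → ↥(Literature.Probability.LatticeModels.box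 4 (sch.L k)), F (fun i => sch.a k • Literature.MathematicalPhysics.QuantumLattice.siteToE ↑(x i)) * ∏ i, ((sch.c r.curvature k * sch.a k ^ 4 * (r.curvature.F (Literature.MathematicalPhysics.QuantumLattice.configShift (-↑(x i)) (Literature.MathematicalPhysics.QuantumLattice.torusLift (sch.side k) U)) - sch.m r.curvature k) : ℝ) : ℂ) ∂(Literature.MathematicalPhysics.QuantumFieldTheory.wilsonMeasure r.ρ (sch.β k))) → Tendsto sch.β atTop atTop → (∀ k : ℕ, sch.m r.curvature k = ∫ U : Literature.MathematicalPhysics.QuantumFieldTheory.GaugeConfig 4 (sch.side k) G, r.curvature.F (Literature.MathematicalPhysics.QuantumLattice.torusLift (sch.side k) U) ∂(Literature.MathematicalPhysics.QuantumFieldTheory.wilsonMeasure r.ρ (sch.β k))) → (∃ (s : ℕ) (α β' : ℝ), ∀ (n : ℕ) (F : SchwartzMap (Fin n → EuclideanSpace ℝ (Fin 4)) ℂ), Literature.MathematicalPhysics.AQFT.IsOffDiagonal F → ∀ᶠ k in atTop, ‖LS k n F‖ ≤ α * (n.factorial : ℝ) ^ β' * Literature.MathematicalPhysics.QuantumLattice.schwartzNorm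 (n * s) F) → (∃ (f g : SchwartzMap (Fin 1 → EuclideanSpace ℝ (Fin 4)) ℂ) (H : SchwartzMap (Fin (1 + 1) → EuclideanSpace ℝ (Fin 4)) ℂ), Literature.MathematicalPhysics.QuantumLattice.IsTimeOrdered f ∧ Literature.MathematicalPhysics.QuantumLattice.IsTimeOrdered g ∧ Literature.MathematicalPhysics.QuantumLattice.IsAppendTensorOf H (Literature.MathematicalPhysics.QuantumLattice.osAdjoint f) g ∧ ∃ δ : ℝ, 0 < δ ∧ ∀ᶠ k in atTop, δ ≤ ‖LS k (1 + 1) H‖) → (∃ Δ : ℝ, 0 < Δ ∧ ∀ (n m : ℕ) (F : SchwartzMap (Fin n → EuclideanSpace ℝ (Fin 4)) ℂ) (G' : SchwartzMap (Fin m → EuclideanSpace ℝ (Fin 4)) ℂ), Literature.MathematicalPhysics.QuantumLattice.IsTimeOrdered F → Literature.MathematicalPhysics.QuantumLattice.IsTimeOrdered G' → ∃ C : ℝ, ∀ t : ℝ, 0 ≤ t → ∀ᶠ k in atTop, ∀ H : SchwartzMap (Fin (n + m) → EuclideanSpace ℝ (Fin 4)) ℂ, Literature.MathematicalPhysics.QuantumLattice.IsAppendTensorOf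 H (Literature.MathematicalPhysics.QuantumLattice.osAdjoint F) (Literature.MathematicalPhysics.QuantumLattice.translateMulti (EuclideanSpace.single 0 t) G') → ‖LS k (n + m) H - LS k n (Literature.MathematicalPhysics.QuantumLattice.osAdjoint F) * LS k m G'‖ ≤ C * Real.exp (-Δ * t)) → ∃ (s₃ : ℂ) (φ : ℕ → ℕ) (f g h : ℕ → SchwartzMap (EuclideanSpace ℝ (Fin 4)) ℂ) (F₃ : ℕ → SchwartzMap (Fin 3 → EuclideanSpace ℝ (Fin 4)) ℂ) (w : ℕ → ℝ), s₃ ≠ 0 ∧ StrictMono φ ∧ (∀ j, 0 < w j) ∧ (∀ j, Literature.MathematicalPhysics.QuantumLattice.IsTensorOf (F₃ j) ![f j, g j, h j] ∧ Literature.MathematicalPhysics.AQFT.IsOffDiagonal (F₃ j)) ∧ ∀ ε : ℝ, 0 < ε → ∀ᶠ j in atTop, ∀ᶠ k in atTop, ‖LS (φ k) 3 (F₃ j) / (w j : ℂ) - s₃‖ ≤ ε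

/-- The glue of the split, closed by the LANDED `ContinuumLegGivenGap_of_subs_all` (p145379), fourth component. -/
theorem ContinuumLegGivenGap_of_subs_HR :
    XiDiverges → VolumeUniformUVEngine → SkewnessWindowNLO →
      Summit.QuantumFields.YangMills.Theses.HyperbolicRegulator.ContinuumLegGivenGap :=
  fun h₁ h₂ h₃ =>
    (Summit.QuantumFields.YangMills.Theorems.ContinuumLegGivenGap.ContinuumLegGivenGap_of_subs_all h₁ h₂ h₃).2.2.2.1

/-- by-name identity checks with the existing declarations -/
example : XiDiverges ↔ Summit.QuantumFields.YangMills.Theses.DirichletWindow.XiDiverges := Iff.rfl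

end Summit.QuantumFields.YangMills.Theses.HyperbolicRegulatorSplitMock
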